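import Literature.IUT.HodgeArakelov.GaloisPairCyclotomesGenuineRigidityUnits
import Literature.AnabelianGeometry.AbsoluteAnabelian.GaloisCyclotomeTransportNaturality
import HarnessLib

/-!
# NV-L6/GalRigidityInput at the GENUINE `AbsTopMonoids` — UNCONDITIONAL (input (b) = [AbsTopIII] Rmk. 3.2.1
# naturality, discharged by local class field theory)

Mochizuki, *Inter-universal Teichmüller theory II*, §1, Cor. 1.11 (a), kurims manuscript (Dec. 2020) p. 49 ll. 9–21
("the cyclotomic rigidity isomorphism `μ_Ẑ(G) ⥲ μ_Ẑ(O^×(G))` obtained by applying to the MLF-Galois pair determined by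
`G ↷ O^⊳(G)` the algorithm … [AbsTopIII], Remark 3.2.1") [claim: Mochizuki2012, status: disputed] (IUTchII §1 Cor 1.11,
kurims p.49); Mochizuki, *Topics in absolute anabelian geometry III*, Rmk. 3.2.1 p. 73 [cite: MochizukiAbsTopIII2015,
Remark 3.2.1 p.73]; Mochizuki, *The absolute anabelian geometry of hyperbolic curves* (2004), Prop. 1.2.1 (vi)(vii)
pp. 10–11 [cite: MochizukiAbsAnab2004, Prop 1.2.1 (vi) p.10].

abc-iut cell; seat abc-iut-L6-t11 (gen 6, row «RMK321-NAT», L4-lead QUICK RULINGS #4f «the whole of (b) is yours»; the row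
holder abc-iut-w4-d030 g2 closed 05:48:24Z naming this one-line corollary as mine).  CLOSER of the chain
  abc-iut-w4-d024 `GalRigidityInput` (interface, p416294) ← abc-iut-L6-t13 `AbsTopMonoids.genuineOfModel` (B9 genuine
  producer, p421397) ← abc-iut-w4-d030 `nonempty_galRigidityInput_genuineOfModel_of_muLift_natural` (reduction to (b1),
  p421900/p423689/p424836; (b2) «`ψ̄_φ|_{𝒪^⊳} = liftM φ`» by abc-iut-L6-t13's `Prop121vii.liftM_coe_eq_of_unitsTransport` and
  abc-iut-L4-d3's `Prop121vii.unitsTransport_holds`) ← (b1) abc-iut-L6-t11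
  `TorsionReciprocityData.exists_torsionReciprocityData_natural` (GaloisCyclotomeTransportNaturality, p425502: the LCFT
  identification `μ_{ℚ/ℤ}(G_k) ≅ μ(k̄)` — torsion of `Art⁻¹` through the Verlagerung — is natural under EVERY topological
  automorphism `φ` of `G_k`, transported by THE units transport `ψ̄_φ`):
* `nonempty_galRigidityInput_genuineOfModel_holds` — for every non-archimedean local field `k` of characteristic `0` and every
  model identification `ε` (with abc-iut-L6-t13's hypotheses `hΔ`, `hq` of the genuine producer),
  `GalRigidityInput (AbsTopMonoids.genuineOfModel S (MLFClosure.std k) ε hΔ hq)` is INHABITED — no residual hypothesis.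
HONEST FRAMING: this certifies the non-vacuity of an [IUTchII] Cor. 1.11 input structure at the genuine monoids of the standard
closure (§4(iii) of the cell's adjudication record); the `Ism`-side of `genuineOfModel` is the degenerate one declared by its
producer; nothing here bears on [IUTchIII] Cor. 3.12 and no side is taken; inhabited ≠ endorsed.  Proof-only, no definitions.
-/

noncomputable section

namespace Literature.IUT.HodgeArakelov

open CategoryTheory Literature.AnabelianGeometry.AbsoluteAnabelian

namespace AbsTopMonoids.Genuine

variable (k : Type) [Field k] [CharZero k] [ValuativeRel k] [TopologicalSpace k] [IsNonarchimedeanLocalField k]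
  {S : ThetaSetting.{0}} [CompactSpace S.Gk]
  (ε : S.Gk ≃ₜ* (ModelMLFGaloisData.galois (MLFClosure.std k).k (MLFClosure.std k).K).tmPair.Pi)
  (hΔ : ∀ f : S.PiX ≃ₜ* S.PiX, S.DeltaX.map f.toMulEquiv.toMonoidHom = S.DeltaX)
  (hq : Nonempty (TopGroup.quot S.PiX S.DeltaX ≃ₜ* S.Gk))

/-- **NV-L6/GalRigidityInput at the genuine `AbsTopMonoids` of the standard closure — UNCONDITIONAL.**  The LCFT torsion
reciprocity data `D` of `exists_torsionReciprocityData_natural` (abc-iut-L6-t11: `D.muLift ∘ μ_{ℚ/ℤ}(φ) = ψ̄_φ ∘ D.muLift` for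
every topological automorphism `φ` of `Gal(k̄/k)` and every `φ`-equivariant uniformiser-preserving `ψ̄_φ : k̄ˣ ⥲ k̄ˣ` —
[AbsTopIII] Rmk. 3.2.1 naturality / [AbsAnab] Prop. 1.2.1 (vi)) fed to abc-iut-w4-d030's
`nonempty_galRigidityInput_genuineOfModel_of_muLift_natural`. [claim: Mochizuki2012, status: disputed]
(IUTchII §1 Cor 1.11, kurims p.49) -/
theorem nonempty_galRigidityInput_genuineOfModel_holds :
    Nonempty (GalRigidityInput (AbsTopMonoids.genuineOfModel S (MLFClosure.std k) ε hΔ hq)) := by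
  obtain ⟨D, hD⟩ := TorsionReciprocityData.exists_torsionReciprocityData_natural k
  exact nonempty_galRigidityInput_genuineOfModel_of_muLift_natural k ε hΔ hq D
    fun φ ψ hψ hU => (hD φ ψ hψ hU).1

end AbsTopMonoids.Genuine

end Literature.IUT.HodgeArakelov

end
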